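import Mathlib
import Summits.ValiantsHypothesis.ValiantsHypothesis.Theorems.LacunarySymmetroidMatrixDescartesDominatedWindow

/-!
# `MatrixDescartes` (stmt-ValiantsHypothesis-18050) — dominated windows at the two ENDS of the scale axis

HONEST FRAMING.  Cell `pub-symmetroid`, seat `val-sym-mdr-p2` (gen 4); helper file `--supports` the crux
`Theses.LacunarySymmetroid.MatrixDescartes`.  ENGINE lemmas completing `…DominatedWindow` (one window of the
regime-window principle); nothing here bears on the crux in general, on `stub_twoSided`, on `DoorA26` / `DoorA34`, or
on `VP ≠ VNP`.

`dominatedWindow_mono` (tree) asks for a dominating NSD letter `μ' < π` and a dominating PSD letter `μ > π` even when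
the corresponding bad set is empty; at the ENDS of a sign word (pivot in the first or last block) such letters need not
exist.  Here: `dominatedWindow_mono_left` — NO bad letters below the pivot (every letter below is NSD), window
`(0, b]`, only `μ > π` needed; `dominatedWindow_mono_right` — NO bad letters above (every letter above is PSD), window
`[a, ∞)`, only `μ' < π` needed.  With `…RegimeWindowsToolkit` (`posRoots_Ioo/Ico/Ici_le_of_mono/anti`) the
α-window assembly of the dominated sign-word law `Z₊ ≤ α·card ι` (Cameron–Psarrakos `n·α` under dominance) uses
`_left` for the first window, `dominatedWindow_mono` for the middle ones and `_right` for the last (non-increasing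
windows via `−F`).  [folklore] Mathlib + tree lemmas; axioms `propext`, `Classical.choice`, `Quot.sound`.
-/

-- layout Summits/ValiantsHypothesis/ValiantsHypothesis forces the duplicated namespace component
set_option linter.dupNamespace false

namespace Summit.ValiantsHypothesis.ValiantsHypothesis.Theorems.LacunarySymmetroidMatrixDescartes

open Polynomial Matrix Finset
open scoped BigOperators

namespace DominatedWindow

variable {K : ℕ}

/-- **Scalar dominated window, no bad letters below** (first window `(0, b]`). [folklore] -/
theorem scalar_nonneg_left (d : Fin K → ℕ) (hd : StrictMono d) (π μ : Fin K) (hπμ : π < μ)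
    (pos : Fin K → Prop) [DecidablePred pos] (hμpos : pos μ)
    (q : Fin K → ℝ) (hsign : ∀ l, l ≠ π → (pos l → 0 ≤ q l) ∧ (¬ pos l → q l ≤ 0))
    (hnoB : ∀ l, l < π → ¬ pos l) (hbadA : ∀ l, π < l → ¬ pos l → μ < l) (b : ℝ)
    (hdomA : ∑ l ∈ univ.filter (fun l => π < l ∧ ¬ pos l), ((d l - d π : ℕ) : ℝ) * b ^ (d l - d μ) * (-q l)
        ≤ ((d μ - d π : ℕ) : ℝ) * q μ)
    {s t : ℝ} (hs : 0 < s) (hst : s ≤ t) (htb : t ≤ b) :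
    0 ≤ ∑ l, (t ^ d l * (t ^ d π)⁻¹ - s ^ d l * (s ^ d π)⁻¹) * q l := by
  have ht : 0 < t := hs.trans_le hst
  set f : Fin K → ℝ := fun l => (t ^ d l * (t ^ d π)⁻¹ - s ^ d l * (s ^ d π)⁻¹) * q l with hf
  -- classify the indices: BA (bad above), BB (bad below), and the rest (pivot + good letters)
  set BA := univ.filter (fun l : Fin K => π < l ∧ ¬ pos l) with hBA
  set BB := univ.filter (fun l : Fin K => l < π ∧ pos l) with hBB
  -- (1) good terms and the pivot term are nonnegative
  have hgood : ∀ l, l ∉ BA → l ∉ BB → 0 ≤ f l := by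
    intro l hlA hlB
    simp only [hf]
    rcases lt_trichotomy l π with hlt | heq | hgt
    · -- below the pivot and not bad: NSD, coefficient `(u^{d_π − d_l})⁻¹` non-increasing
      have hnp : ¬ pos l := fun hp => hlB (Finset.mem_filter.2 ⟨Finset.mem_univ _, hlt, hp⟩)
      have hle : d l ≤ d π := hd.monotone hlt.le
      rw [DominantMiddle.coeff_below ht.ne' hle, DominantMiddle.coeff_below hs.ne' hle]
      exact mul_nonneg_of_nonpos_of_nonpos
        (sub_nonpos.2 (inv_anti₀ (pow_pos hs _) (pow_le_pow_left₀ hs.le hst _))) ((hsign l hlt.ne).2 hnp)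
    · subst heq
      rw [mul_inv_cancel₀ (pow_ne_zero _ ht.ne'), mul_inv_cancel₀ (pow_ne_zero _ hs.ne'), sub_self, zero_mul]
    · -- above the pivot and not bad: PSD, coefficient `u^{d_l − d_π}` non-decreasing
      have hp : pos l := by
        by_contra hnp
        exact hlA (Finset.mem_filter.2 ⟨Finset.mem_univ _, hgt, hnp⟩)
      have hle : d π ≤ d l := hd.monotone hgt.le
      rw [DominantMiddle.coeff_above ht.ne' hle, DominantMiddle.coeff_above hs.ne' hle]
      exact mul_nonneg (sub_nonneg.2 (pow_le_pow_left₀ hs.le hst _)) ((hsign l hgt.ne').1 hp)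
  -- (2) the bad-above block is dominated by `μ`:  `γ_μ · (f μ + ∑_{BA} f) ≥ 0`
  have hdμ : d π < d μ := hd hπμ
  have hγμ : (0 : ℝ) < ((d μ - d π : ℕ) : ℝ) := by exact_mod_cast Nat.sub_pos_of_lt hdμ
  have hfμ : f μ = (t ^ (d μ - d π) - s ^ (d μ - d π)) * q μ := by
    simp only [hf]
    rw [DominantMiddle.coeff_above ht.ne' hdμ.le, DominantMiddle.coeff_above hs.ne' hdμ.le]
  have hA_bound : ∀ l ∈ BA,
      -( ((d l - d π : ℕ) : ℝ) * b ^ (d l - d μ) * (t ^ (d μ - d π) - s ^ (d μ - d π)) * (-q l))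
        ≤ ((d μ - d π : ℕ) : ℝ) * f l := by
    intro l hl
    obtain ⟨hπl, hnp⟩ := (Finset.mem_filter.1 hl).2
    have hμl : d μ < d l := hd (hbadA l hπl hnp)
    have hle : d π ≤ d l := (hdμ.trans hμl).le
    simp only [hf]
    rw [DominantMiddle.coeff_above ht.ne' hle, DominantMiddle.coeff_above hs.ne' hle]
    have ek : d l - d π = (d μ - d π) + (d l - d μ) := by omega
    have hcmp := DominantMiddle.pow_sub_pow_window hs.le hst htb (d μ - d π) (d l - d μ) (Nat.sub_pos_of_lt hdμ)
    rw [← ek] at hcmp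
    have ecast : ((d μ - d π : ℕ) : ℝ) + ((d l - d μ : ℕ) : ℝ) = ((d l - d π : ℕ) : ℝ) := by
      rw [← Nat.cast_add, ← ek]
    rw [ecast] at hcmp
    have hql : 0 ≤ -q l := neg_nonneg.2 ((hsign l hπl.ne').2 hnp)
    have := mul_le_mul_of_nonneg_right hcmp hql
    nlinarith [this]
  have hA_sum : -((t ^ (d μ - d π) - s ^ (d μ - d π))
        * ∑ l ∈ BA, ((d l - d π : ℕ) : ℝ) * b ^ (d l - d μ) * (-q l))
      ≤ ((d μ - d π : ℕ) : ℝ) * ∑ l ∈ BA, f l := by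
    rw [Finset.mul_sum, Finset.mul_sum, ← Finset.sum_neg_distrib]
    refine Finset.sum_le_sum fun l hl => ?_
    have hb' := hA_bound l hl
    have e : (t ^ (d μ - d π) - s ^ (d μ - d π)) * (((d l - d π : ℕ) : ℝ) * b ^ (d l - d μ) * (-q l))
        = ((d l - d π : ℕ) : ℝ) * b ^ (d l - d μ) * (t ^ (d μ - d π) - s ^ (d μ - d π)) * (-q l) := by
      ring
    rw [e]
    exact hb'
  have htsA : 0 ≤ t ^ (d μ - d π) - s ^ (d μ - d π) := sub_nonneg.2 (pow_le_pow_left₀ hs.le hst _)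
  have hdomA' := mul_le_mul_of_nonneg_left hdomA htsA
  have hkeyA : 0 ≤ ∑ l ∈ BA, f l + f μ := by
    have h0 : 0 ≤ ((d μ - d π : ℕ) : ℝ) * (∑ l ∈ BA, f l + f μ) := by
      rw [mul_add, hfμ]
      nlinarith [hA_sum, hdomA']
    exact nonneg_of_mul_nonneg_right h0 hγμ
  -- (4) assemble: `BB = ∅`; split `univ` into BA, {μ}, rest
  have hBB0 : BB = ∅ := by
    rw [Finset.eq_empty_iff_forall_notMem]
    intro l hl
    obtain ⟨hlπ, hp⟩ := (Finset.mem_filter.1 hl).2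
    exact hnoB l hlπ hp
  have hμA : μ ∉ BA := fun h => (Finset.mem_filter.1 h).2.2 hμpos
  set R := (BAᶜ).erase μ with hR
  have hrest : 0 ≤ ∑ l ∈ R, f l := by
    refine Finset.sum_nonneg fun l hl => ?_
    have hl1 := Finset.mem_of_mem_erase hl
    rw [Finset.mem_compl] at hl1
    exact hgood l hl1 (by rw [hBB0]; exact Finset.notMem_empty l)
  have htot : ∑ l, f l = (∑ l ∈ BA, f l + f μ) + ∑ l ∈ R, f l := by
    have h1 : ∑ l, f l = ∑ l ∈ BA, f l + ∑ l ∈ BAᶜ, f l := (Finset.sum_add_sum_compl BA f).symm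
    have hμmem : μ ∈ BAᶜ := Finset.mem_compl.2 hμA
    have h3 : ∑ l ∈ BAᶜ, f l = f μ + ∑ l ∈ R, f l := by rw [← Finset.add_sum_erase _ _ hμmem]
    rw [h1, h3]
    ring
  show 0 ≤ ∑ l, f l
  rw [htot]
  linarith

/-- **Scalar dominated window, no bad letters above** (last window `[a, ∞)`). [folklore] -/
theorem scalar_nonneg_right (d : Fin K → ℕ) (hd : StrictMono d) (π μ' : Fin K) (hμ'π : μ' < π)
    (pos : Fin K → Prop) [DecidablePred pos] (hμ'neg : ¬ pos μ')
    (q : Fin K → ℝ) (hsign : ∀ l, l ≠ π → (pos l → 0 ≤ q l) ∧ (¬ pos l → q l ≤ 0))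
    (hbadB : ∀ l, l < π → pos l → l < μ') (hnoA : ∀ l, π < l → pos l) (a : ℝ) (ha : 0 < a)
    (hdomB : ∑ l ∈ univ.filter (fun l => l < π ∧ pos l), ((d π - d l : ℕ) : ℝ) * (a⁻¹) ^ (d μ' - d l) * q l
        ≤ ((d π - d μ' : ℕ) : ℝ) * (-q μ'))
    {s t : ℝ} (has : a ≤ s) (hst : s ≤ t) :
    0 ≤ ∑ l, (t ^ d l * (t ^ d π)⁻¹ - s ^ d l * (s ^ d π)⁻¹) * q l := by
  have hs : 0 < s := ha.trans_le has
  have ht : 0 < t := hs.trans_le hst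
  set f : Fin K → ℝ := fun l => (t ^ d l * (t ^ d π)⁻¹ - s ^ d l * (s ^ d π)⁻¹) * q l with hf
  -- classify the indices: BA (bad above), BB (bad below), and the rest (pivot + good letters)
  set BA := univ.filter (fun l : Fin K => π < l ∧ ¬ pos l) with hBA
  set BB := univ.filter (fun l : Fin K => l < π ∧ pos l) with hBB
  -- (1) good terms and the pivot term are nonnegative
  have hgood : ∀ l, l ∉ BA → l ∉ BB → 0 ≤ f l := by
    intro l hlA hlB
    simp only [hf]
    rcases lt_trichotomy l π with hlt | heq | hgt
    · -- below the pivot and not bad: NSD, coefficient `(u^{d_π − d_l})⁻¹` non-increasing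
      have hnp : ¬ pos l := fun hp => hlB (Finset.mem_filter.2 ⟨Finset.mem_univ _, hlt, hp⟩)
      have hle : d l ≤ d π := hd.monotone hlt.le
      rw [DominantMiddle.coeff_below ht.ne' hle, DominantMiddle.coeff_below hs.ne' hle]
      exact mul_nonneg_of_nonpos_of_nonpos
        (sub_nonpos.2 (inv_anti₀ (pow_pos hs _) (pow_le_pow_left₀ hs.le hst _))) ((hsign l hlt.ne).2 hnp)
    · subst heq
      rw [mul_inv_cancel₀ (pow_ne_zero _ ht.ne'), mul_inv_cancel₀ (pow_ne_zero _ hs.ne'), sub_self, zero_mul]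
    · -- above the pivot and not bad: PSD, coefficient `u^{d_l − d_π}` non-decreasing
      have hp : pos l := by
        by_contra hnp
        exact hlA (Finset.mem_filter.2 ⟨Finset.mem_univ _, hgt, hnp⟩)
      have hle : d π ≤ d l := hd.monotone hgt.le
      rw [DominantMiddle.coeff_above ht.ne' hle, DominantMiddle.coeff_above hs.ne' hle]
      exact mul_nonneg (sub_nonneg.2 (pow_le_pow_left₀ hs.le hst _)) ((hsign l hgt.ne').1 hp)
  -- (3) the bad-below block is dominated by `μ'`:  `γ' · (f μ' + ∑_{BB} f) ≥ 0`
  have hdμ' : d μ' < d π := hd hμ'π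
  have hγ' : (0 : ℝ) < ((d π - d μ' : ℕ) : ℝ) := by exact_mod_cast Nat.sub_pos_of_lt hdμ'
  have hσ : 0 ≤ t⁻¹ := (inv_pos.2 ht).le
  have hσρ : t⁻¹ ≤ s⁻¹ := inv_anti₀ hs hst
  have hρa : s⁻¹ ≤ a⁻¹ := inv_anti₀ ha has
  have hfμ' : f μ' = ((s⁻¹) ^ (d π - d μ') - (t⁻¹) ^ (d π - d μ')) * (-q μ') := by
    simp only [hf]
    rw [DominantMiddle.coeff_below ht.ne' hdμ'.le, DominantMiddle.coeff_below hs.ne' hdμ'.le, ← inv_pow, ← inv_pow]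
    ring
  have hB_bound : ∀ l ∈ BB,
      -( ((d π - d l : ℕ) : ℝ) * (a⁻¹) ^ (d μ' - d l) * ((s⁻¹) ^ (d π - d μ') - (t⁻¹) ^ (d π - d μ')) * q l)
        ≤ ((d π - d μ' : ℕ) : ℝ) * f l := by
    intro l hl
    obtain ⟨hlπ, hp⟩ := (Finset.mem_filter.1 hl).2
    have hlμ : d l < d μ' := hd (hbadB l hlπ hp)
    have hle : d l ≤ d π := (hlμ.trans hdμ').le
    simp only [hf]
    rw [DominantMiddle.coeff_below ht.ne' hle, DominantMiddle.coeff_below hs.ne' hle, ← inv_pow, ← inv_pow]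
    have ek : d π - d l = (d π - d μ') + (d μ' - d l) := by omega
    have hcmp := DominantMiddle.pow_sub_pow_window hσ hσρ hρa (d π - d μ') (d μ' - d l)
      (Nat.sub_pos_of_lt hdμ')
    rw [← ek] at hcmp
    have ecast : ((d π - d μ' : ℕ) : ℝ) + ((d μ' - d l : ℕ) : ℝ) = ((d π - d l : ℕ) : ℝ) := by
      rw [← Nat.cast_add, ← ek]
    rw [ecast] at hcmp
    have := mul_le_mul_of_nonneg_right hcmp ((hsign l hlπ.ne).1 hp)
    nlinarith [this]
  have hB_sum : -(((s⁻¹) ^ (d π - d μ') - (t⁻¹) ^ (d π - d μ'))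
        * ∑ l ∈ BB, ((d π - d l : ℕ) : ℝ) * (a⁻¹) ^ (d μ' - d l) * q l)
      ≤ ((d π - d μ' : ℕ) : ℝ) * ∑ l ∈ BB, f l := by
    rw [Finset.mul_sum, Finset.mul_sum, ← Finset.sum_neg_distrib]
    refine Finset.sum_le_sum fun l hl => ?_
    have hb' := hB_bound l hl
    have e : ((s⁻¹) ^ (d π - d μ') - (t⁻¹) ^ (d π - d μ'))
          * (((d π - d l : ℕ) : ℝ) * (a⁻¹) ^ (d μ' - d l) * q l)
        = ((d π - d l : ℕ) : ℝ) * (a⁻¹) ^ (d μ' - d l)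
          * ((s⁻¹) ^ (d π - d μ') - (t⁻¹) ^ (d π - d μ')) * q l := by ring
    rw [e]
    exact hb'
  have htsB : 0 ≤ (s⁻¹) ^ (d π - d μ') - (t⁻¹) ^ (d π - d μ') :=
    sub_nonneg.2 (pow_le_pow_left₀ hσ hσρ _)
  have hdomB' := mul_le_mul_of_nonneg_left hdomB htsB
  have hkeyB : 0 ≤ ∑ l ∈ BB, f l + f μ' := by
    have h0 : 0 ≤ ((d π - d μ' : ℕ) : ℝ) * (∑ l ∈ BB, f l + f μ') := by
      rw [mul_add, hfμ']
      nlinarith [hB_sum, hdomB']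
    exact nonneg_of_mul_nonneg_right h0 hγ'
  -- (4) assemble: `BA = ∅`; split `univ` into BB, {μ'}, rest
  have hBA0 : BA = ∅ := by
    rw [Finset.eq_empty_iff_forall_notMem]
    intro l hl
    obtain ⟨hπl, hnp⟩ := (Finset.mem_filter.1 hl).2
    exact hnp (hnoA l hπl)
  have hμ'B : μ' ∉ BB := fun h => hμ'neg (Finset.mem_filter.1 h).2.2
  set R := (BBᶜ).erase μ' with hR
  have hrest : 0 ≤ ∑ l ∈ R, f l := by
    refine Finset.sum_nonneg fun l hl => ?_
    have hl1 := Finset.mem_of_mem_erase hl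
    rw [Finset.mem_compl] at hl1
    exact hgood l (by rw [hBA0]; exact Finset.notMem_empty l) hl1
  have htot : ∑ l, f l = (∑ l ∈ BB, f l + f μ') + ∑ l ∈ R, f l := by
    have h1 : ∑ l, f l = ∑ l ∈ BB, f l + ∑ l ∈ BBᶜ, f l := (Finset.sum_add_sum_compl BB f).symm
    have hμmem : μ' ∈ BBᶜ := Finset.mem_compl.2 hμ'B
    have h3 : ∑ l ∈ BBᶜ, f l = f μ' + ∑ l ∈ R, f l := by rw [← Finset.add_sum_erase _ _ hμmem]
    rw [h1, h3]
    ring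
  show 0 ≤ ∑ l, f l
  rw [htot]
  linarith

end DominatedWindow

/-- **Dominated window with no bad letters below** (every letter below the pivot NSD): `F/x^{d_π}` is Loewner
non-decreasing on `(0, b]`; only the upper dominator `μ > π` is needed. [folklore] -/
theorem dominatedWindow_mono_left {ι : Type} [Fintype ι] [DecidableEq ι] {K : ℕ} (d : Fin K → ℕ) (hd : StrictMono d)
    (S : Fin K → Matrix ι ι ℝ) (hS : ∀ l, (S l).IsSymm) (π μ : Fin K) (hπμ : π < μ)
    (pos : Fin K → Prop) [DecidablePred pos] (hμpos : pos μ)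
    (hsign : ∀ l, l ≠ π → (pos l → (S l).PosSemidef) ∧ (¬ pos l → (-S l).PosSemidef))
    (hnoB : ∀ l, l < π → ¬ pos l) (hbadA : ∀ l, π < l → ¬ pos l → μ < l) (b : ℝ)
    (hdomA : ((((d μ - d π : ℕ) : ℝ)) • S μ
      - ∑ l ∈ univ.filter (fun l => π < l ∧ ¬ pos l), (((d l - d π : ℕ) : ℝ) * b ^ (d l - d μ)) • (-S l)
        ).PosSemidef)
    (s t : ℝ) (hs : 0 < s) (hst : s ≤ t) (htb : t ≤ b) :
    (((t ^ d π)⁻¹ • ∑ l, (t ^ d l) • S l) - ((s ^ d π)⁻¹ • ∑ l, (s ^ d l) • S l)).PosSemidef := by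
  have hsymm : (((t ^ d π)⁻¹ • ∑ l, (t ^ d l) • S l) - ((s ^ d π)⁻¹ • ∑ l, (s ^ d l) • S l)).IsHermitian := by
    have h0 : (((t ^ d π)⁻¹ • ∑ l, (t ^ d l) • S l) - ((s ^ d π)⁻¹ • ∑ l, (s ^ d l) • S l)).IsSymm := by
      unfold Matrix.IsSymm
      rw [Matrix.transpose_sub, (LoewnerSector.smul_family_isSymm d S hS _ t).eq,
        (LoewnerSector.smul_family_isSymm d S hS _ s).eq]
    exact Matrix.isHermitian_iff_isSymm.2 h0
  refine Matrix.PosSemidef.of_dotProduct_mulVec_nonneg hsymm fun v => ?_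
  rw [star_trivial, DominantMiddle.quadForm_diff]
  -- scalar data
  have hsq : ∀ l, l ≠ π → (pos l → 0 ≤ v ⬝ᵥ (S l *ᵥ v)) ∧ (¬ pos l → v ⬝ᵥ (S l *ᵥ v) ≤ 0) := by
    intro l hl
    refine ⟨fun hp => ?_, fun hnp => ?_⟩
    · simpa only [star_trivial] using ((hsign l hl).1 hp).dotProduct_mulVec_nonneg v
    · have h0 := ((hsign l hl).2 hnp).dotProduct_mulVec_nonneg v
      rw [star_trivial, Matrix.neg_mulVec, dotProduct_neg] at h0
      linarith
  have hdA : ∑ l ∈ univ.filter (fun l => π < l ∧ ¬ pos l),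
      ((d l - d π : ℕ) : ℝ) * b ^ (d l - d μ) * (-(v ⬝ᵥ (S l *ᵥ v)))
        ≤ ((d μ - d π : ℕ) : ℝ) * (v ⬝ᵥ (S μ *ᵥ v)) := by
    have h0 := hdomA.dotProduct_mulVec_nonneg v
    rw [star_trivial, Matrix.sub_mulVec, dotProduct_sub, Matrix.smul_mulVec, dotProduct_smul, smul_eq_mul,
      DominantMiddle.quadForm_finsum] at h0
    have e : ∀ l, (((d l - d π : ℕ) : ℝ) * b ^ (d l - d μ)) * (v ⬝ᵥ ((-S l) *ᵥ v))
        = ((d l - d π : ℕ) : ℝ) * b ^ (d l - d μ) * (-(v ⬝ᵥ (S l *ᵥ v))) := by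
      intro l; rw [Matrix.neg_mulVec, dotProduct_neg]
    simp_rw [e] at h0
    linarith
  exact DominatedWindow.scalar_nonneg_left d hd π μ hπμ pos hμpos (fun l => v ⬝ᵥ (S l *ᵥ v)) hsq
    hnoB hbadA b hdA hs hst htb

/-- **Dominated window with no bad letters above** (every letter above the pivot PSD): `F/x^{d_π}` is Loewner
non-decreasing on `[a, ∞)`; only the lower dominator `μ' < π` is needed. [folklore] -/
theorem dominatedWindow_mono_right {ι : Type} [Fintype ι] [DecidableEq ι] {K : ℕ} (d : Fin K → ℕ) (hd : StrictMono d)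
    (S : Fin K → Matrix ι ι ℝ) (hS : ∀ l, (S l).IsSymm) (π μ' : Fin K) (hμ'π : μ' < π)
    (pos : Fin K → Prop) [DecidablePred pos] (hμ'neg : ¬ pos μ')
    (hsign : ∀ l, l ≠ π → (pos l → (S l).PosSemidef) ∧ (¬ pos l → (-S l).PosSemidef))
    (hbadB : ∀ l, l < π → pos l → l < μ') (hnoA : ∀ l, π < l → pos l) (a : ℝ) (ha : 0 < a)
    (hdomB : ((((d π - d μ' : ℕ) : ℝ)) • (-S μ')
      - ∑ l ∈ univ.filter (fun l => l < π ∧ pos l), (((d π - d l : ℕ) : ℝ) * (a⁻¹) ^ (d μ' - d l)) • S l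
        ).PosSemidef)
    (s t : ℝ) (has : a ≤ s) (hst : s ≤ t) :
    (((t ^ d π)⁻¹ • ∑ l, (t ^ d l) • S l) - ((s ^ d π)⁻¹ • ∑ l, (s ^ d l) • S l)).PosSemidef := by
  have hsymm : (((t ^ d π)⁻¹ • ∑ l, (t ^ d l) • S l) - ((s ^ d π)⁻¹ • ∑ l, (s ^ d l) • S l)).IsHermitian := by
    have h0 : (((t ^ d π)⁻¹ • ∑ l, (t ^ d l) • S l) - ((s ^ d π)⁻¹ • ∑ l, (s ^ d l) • S l)).IsSymm := by
      unfold Matrix.IsSymm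
      rw [Matrix.transpose_sub, (LoewnerSector.smul_family_isSymm d S hS _ t).eq,
        (LoewnerSector.smul_family_isSymm d S hS _ s).eq]
    exact Matrix.isHermitian_iff_isSymm.2 h0
  refine Matrix.PosSemidef.of_dotProduct_mulVec_nonneg hsymm fun v => ?_
  rw [star_trivial, DominantMiddle.quadForm_diff]
  -- scalar data
  have hsq : ∀ l, l ≠ π → (pos l → 0 ≤ v ⬝ᵥ (S l *ᵥ v)) ∧ (¬ pos l → v ⬝ᵥ (S l *ᵥ v) ≤ 0) := by
    intro l hl
    refine ⟨fun hp => ?_, fun hnp => ?_⟩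
    · simpa only [star_trivial] using ((hsign l hl).1 hp).dotProduct_mulVec_nonneg v
    · have h0 := ((hsign l hl).2 hnp).dotProduct_mulVec_nonneg v
      rw [star_trivial, Matrix.neg_mulVec, dotProduct_neg] at h0
      linarith
  have hdB : ∑ l ∈ univ.filter (fun l => l < π ∧ pos l),
      ((d π - d l : ℕ) : ℝ) * (a⁻¹) ^ (d μ' - d l) * (v ⬝ᵥ (S l *ᵥ v))
        ≤ ((d π - d μ' : ℕ) : ℝ) * (-(v ⬝ᵥ (S μ' *ᵥ v))) := by
    have h0 := hdomB.dotProduct_mulVec_nonneg v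
    rw [star_trivial, Matrix.sub_mulVec, dotProduct_sub, Matrix.smul_mulVec, dotProduct_smul, smul_eq_mul,
      Matrix.neg_mulVec, dotProduct_neg, DominantMiddle.quadForm_finsum] at h0
    linarith
  exact DominatedWindow.scalar_nonneg_right d hd π μ' hμ'π pos hμ'neg (fun l => v ⬝ᵥ (S l *ᵥ v)) hsq
    hbadB hnoA a ha hdB has hst

end Summit.ValiantsHypothesis.ValiantsHypothesis.Theorems.LacunarySymmetroidMatrixDescartes
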